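import Mathlib
import HarnessLib
import Summits.ValiantsHypothesis.ValiantsHypothesis.Theorems.LacunarySymmetroidMatrixDescartesOsculationLawCommutingSheets

/-!
# ValiantsHypothesis / LacunarySymmetroid — crux `MatrixDescartes` (stmt-ValiantsHypothesis-18050, V1),
# line `Cruxes/MatrixDescartes/Lines/osculation_law.lean` («osculation-law»): the COMMUTING / DIAGONAL column,
# part 2 — DIAGONAL letters at every splitting `(r, s)` (MATRIX layer; O1 of director R261/R262, desk RULING #295)

Writer val-port-4 g2 (O1 MATRIX layer) over val-lit-p5 g13's staged text (RULING #295 (b): engine layer = p5's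
`…OsculationLawCommutingSheets.lean :: OsculationCommuting.sheetProduct_count`, p644367, imported BY NAME).

* `pencil_diagonal` / `insertionPoly_diagonal` — for DIAGONAL letters `S l` on `Fin r ⊕ Fin s` the line's insertion pencil
  `Σ_l X₀^{d l} • S_l + X₁ • (I_r ⊕ 0)` is `Matrix.diagonal`, and its determinant is `(∏_{inl} sheets (X₁ + ι g_i)) · ι(∏_{inr} g_j)`
  (`ι = Polynomial.aeval X₀`; `g_k` = the `k`-th diagonal entry, a `K`-nomial on the exponent set `{d l}`).
* `logHessian_aevalX0` — a `b`-free factor has no bordered log-Hessian: `H(ι f) = 0`.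
* `osc_diagonal (r s K d S)` — `(∀ l, (S l).IsDiag) → (osculationSet d S).Finite → ncard ≤ r·(C(K,2) − 1) + C(r,2)·(K − 1)`
  (line vocabulary unfolded verbatim).  A positive zero of a lower entry `g_j` puts the vertical ray `{t₀} × (0,∞)` into the
  set (`OsculationCuspGen.infinite_of_vertical`), so finiteness removes the `ι`-factor; on a sheet zero
  `OsculationGeneric.eval_logHessian_mul_of_eval_eq_zero` reduces `H` to the sheet product and `sheetProduct_count` counts.
* `osc_diagonal_le (m K r s) (hrs : r + s = m)` — the roster bound `m·K² + m²·K` as a corollary.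

The literal `OsculationLawAt`-shaped statements (`osculationLawAt_diagonal`, `osculationLawAt_commuting_top`) are in the
companion `…OsculationCommuting.lean` (part 3).  MATH CAVEAT (port-4 g2, bus 15:08Z): for `s ≥ 1` pairwise-commuting letters
need not commute with `blockProj r s` (witness `m = 2`, `r = s = 1`, letters in `span{I, [[0,1],[1,0]]}`: one non-split
sheet), so the all-splittings commuting law is the `IsDiag` one; «pairwise `Commute`» is the honest hypothesis at `(m, 0)`.

HONEST LABEL: a RESTRICTED-CLASS column (commuting letters; polynomial, far inside `2^{C (K + log₂² m)}`).  NOT the LAW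
`stub_osculationLaw`, not `MatrixDescartes` (stmt-18050), not Conjecture B; `VP ≠ VNP` is NOT proved.  No definitions,
no named facts; Mathlib + tree files by name.
-/

-- `Summit.ValiantsHypothesis.ValiantsHypothesis.…` is the tree's mandated single-conjunct layout (Sub = Summit).
set_option linter.dupNamespace false

noncomputable section

namespace Summit.ValiantsHypothesis.ValiantsHypothesis.Theorems.LacunarySymmetroidMatrixDescartes

namespace OsculationCommuting

open Polynomial
open scoped BigOperators Matrix

/-! ### Part 2 — DIAGONAL letters at every splitting `(r, s)` -/

/-- The bordered log-Hessian of a function of `t` alone vanishes identically. [folklore] -/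
theorem logHessian_aevalX0 (f : ℝ[X]) :
    (MvPolynomial.X 0 * MvPolynomial.pderiv 0 (MvPolynomial.X 0 * MvPolynomial.pderiv 0 (Polynomial.aeval (MvPolynomial.X 0 : MvPolynomial (Fin 2) ℝ) f)) * (MvPolynomial.X 1 * MvPolynomial.pderiv 1 (Polynomial.aeval (MvPolynomial.X 0 : MvPolynomial (Fin 2) ℝ) f)) ^ 2
      - 2 * (MvPolynomial.X 0 * MvPolynomial.pderiv 0 (MvPolynomial.X 1 * MvPolynomial.pderiv 1 (Polynomial.aeval (MvPolynomial.X 0 : MvPolynomial (Fin 2) ℝ) f)))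
        * (MvPolynomial.X 0 * MvPolynomial.pderiv 0 (Polynomial.aeval (MvPolynomial.X 0 : MvPolynomial (Fin 2) ℝ) f)) * (MvPolynomial.X 1 * MvPolynomial.pderiv 1 (Polynomial.aeval (MvPolynomial.X 0 : MvPolynomial (Fin 2) ℝ) f))
      + MvPolynomial.X 1 * MvPolynomial.pderiv 1 (MvPolynomial.X 1 * MvPolynomial.pderiv 1 (Polynomial.aeval (MvPolynomial.X 0 : MvPolynomial (Fin 2) ℝ) f)) * (MvPolynomial.X 0 * MvPolynomial.pderiv 0 (Polynomial.aeval (MvPolynomial.X 0 : MvPolynomial (Fin 2) ℝ) f)) ^ 2) = 0 := by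
  simp only [OsculationRankOne.pderiv_one_aevalX0, mul_zero, map_zero, zero_pow two_ne_zero, sub_zero, zero_add, zero_mul]

/-- The diagonal entry fewnomial `g_k = Σ_l (S l)_kk · X^(d l)` of a family of letters. Its support lies in the image
of the exponent map. [folklore] -/
theorem support_entry_subset {n : Type*} {K : ℕ} (d : Fin K → ℕ) (S : Fin K → Matrix n n ℝ) (k : n) :
    (∑ l, Polynomial.C (S l k k) * X ^ d l).support ⊆ Finset.univ.image d := by
  classical
  intro e he
  rw [mem_support_iff, finsetSum_coeff] at he
  by_contra hne
  apply he
  refine Finset.sum_eq_zero fun l _ => ?_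
  rw [coeff_C_mul, coeff_X_pow, if_neg, mul_zero]
  intro h
  exact hne (Finset.mem_image.2 ⟨l, Finset.mem_univ l, h.symm⟩)

/-- `ι` of the entry fewnomial. [folklore] -/
theorem aevalX0_entry {n : Type*} {K : ℕ} (d : Fin K → ℕ) (S : Fin K → Matrix n n ℝ) (k : n) :
    Polynomial.aeval (MvPolynomial.X 0 : MvPolynomial (Fin 2) ℝ) (∑ l, Polynomial.C (S l k k) * X ^ d l) =
      ∑ l, (MvPolynomial.X (0 : Fin 2) : MvPolynomial (Fin 2) ℝ) ^ d l * MvPolynomial.C (S l k k) := by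
  rw [map_sum]
  refine Finset.sum_congr rfl fun l _ => ?_
  rw [map_mul, map_pow, Polynomial.aeval_C, Polynomial.aeval_X, MvPolynomial.algebraMap_eq, mul_comm]

/-- **The insertion pencil of DIAGONAL letters is a diagonal matrix.** [folklore] -/
theorem pencil_diagonal (r s K : ℕ) (d : Fin K → ℕ) (S : Fin K → Matrix (Fin r ⊕ Fin s) (Fin r ⊕ Fin s) ℝ)
    (hS : ∀ l, (S l).IsDiag) :
    (∑ l, (MvPolynomial.X (0 : Fin 2) : MvPolynomial (Fin 2) ℝ) ^ d l •
              (S l).map (MvPolynomial.C : ℝ →+* MvPolynomial (Fin 2) ℝ)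
            + (MvPolynomial.X (1 : Fin 2) : MvPolynomial (Fin 2) ℝ) •
              (Matrix.fromBlocks 1 0 0 0 : Matrix (Fin r ⊕ Fin s) (Fin r ⊕ Fin s) ℝ).map
                (MvPolynomial.C : ℝ →+* MvPolynomial (Fin 2) ℝ)) =
      Matrix.diagonal (fun k => (∑ l, (MvPolynomial.X (0 : Fin 2) : MvPolynomial (Fin 2) ℝ) ^ d l *
          MvPolynomial.C (S l k k)) + MvPolynomial.X 1 * Sum.elim (fun _ => 1) (fun _ => 0) k) := by
  ext k k'
  simp only [Matrix.add_apply, Matrix.sum_apply, Matrix.smul_apply, Matrix.map_apply, smul_eq_mul]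
  rcases eq_or_ne k k' with rfl | hne
  · rw [Matrix.diagonal_apply_eq]
    congr 1
    rcases k with i | j
    · simp
    · simp
  · rw [Matrix.diagonal_apply_ne _ hne]
    have h1 : ∀ l, S l k k' = 0 := fun l => hS l hne
    have h2 : (Matrix.fromBlocks 1 0 0 0 : Matrix (Fin r ⊕ Fin s) (Fin r ⊕ Fin s) ℝ) k k' = 0 := by
      rcases k with i | j <;> rcases k' with i' | j'
      · have : i ≠ i' := fun h => hne (by rw [h])
        simp [Matrix.one_apply_ne this]
      · simp
      · simp
      · simp
    simp [h1, h2]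

/-- **The insertion polynomial of DIAGONAL letters is a product of sheets times a function of `t`.** [folklore] -/
theorem insertionPoly_diagonal (r s K : ℕ) (d : Fin K → ℕ) (S : Fin K → Matrix (Fin r ⊕ Fin s) (Fin r ⊕ Fin s) ℝ)
    (hS : ∀ l, (S l).IsDiag) :
    (∑ l, (MvPolynomial.X (0 : Fin 2) : MvPolynomial (Fin 2) ℝ) ^ d l •
              (S l).map (MvPolynomial.C : ℝ →+* MvPolynomial (Fin 2) ℝ)
            + (MvPolynomial.X (1 : Fin 2) : MvPolynomial (Fin 2) ℝ) •
              (Matrix.fromBlocks 1 0 0 0 : Matrix (Fin r ⊕ Fin s) (Fin r ⊕ Fin s) ℝ).map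
                (MvPolynomial.C : ℝ →+* MvPolynomial (Fin 2) ℝ)).det =
      (∏ i : Fin r, (MvPolynomial.X 1 + Polynomial.aeval (MvPolynomial.X 0 : MvPolynomial (Fin 2) ℝ) (∑ l, Polynomial.C (S l (Sum.inl i) (Sum.inl i)) * X ^ d l)))
        * Polynomial.aeval (MvPolynomial.X 0 : MvPolynomial (Fin 2) ℝ) (∏ j : Fin s, ∑ l, Polynomial.C (S l (Sum.inr j) (Sum.inr j)) * X ^ d l) := by
  rw [pencil_diagonal r s K d S hS, Matrix.det_diagonal, Fintype.prod_sum_type, map_prod]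
  congr 1
  · refine Finset.prod_congr rfl fun i _ => ?_
    rw [aevalX0_entry, Sum.elim_inl, mul_one, add_comm]
  · refine Finset.prod_congr rfl fun j _ => ?_
    rw [aevalX0_entry, Sum.elim_inr, mul_zero, add_zero]

set_option maxHeartbeats 800000 in
/-- **The COMMUTING column, diagonal form (every splitting).**  For DIAGONAL letters `S l` on `Fin r ⊕ Fin s` and any
exponents `d`, if the line's osculation set (vocabulary of `Cruxes/MatrixDescartes/Lines/osculation_law.lean` unfolded
verbatim: `insertionPoly`, `logHessian`, `osculationSet`) is finite, then
`#osc ≤ r·(C(K,2) − 1) + C(r,2)·(K − 1)`.  (A positive zero of a lower diagonal entry would put a vertical ray into the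
set, so finiteness excludes it; then `H(Ψ·ι(M)) = M³·H(Ψ)` on `Ψ = 0` reduces to `sheetProduct_count`.) [folklore] -/
theorem osc_diagonal (r s K : ℕ) (d : Fin K → ℕ) (S : Fin K → Matrix (Fin r ⊕ Fin s) (Fin r ⊕ Fin s) ℝ)
    (hS : ∀ l, (S l).IsDiag)
    (hfin : {p : Fin 2 → ℝ | 0 < p 0 ∧ 0 < p 1 ∧ MvPolynomial.eval p (∑ l, (MvPolynomial.X (0 : Fin 2) : MvPolynomial (Fin 2) ℝ) ^ d l •
              (S l).map (MvPolynomial.C : ℝ →+* MvPolynomial (Fin 2) ℝ)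
            + (MvPolynomial.X (1 : Fin 2) : MvPolynomial (Fin 2) ℝ) •
              (Matrix.fromBlocks 1 0 0 0 : Matrix (Fin r ⊕ Fin s) (Fin r ⊕ Fin s) ℝ).map
                (MvPolynomial.C : ℝ →+* MvPolynomial (Fin 2) ℝ)).det = 0 ∧
      MvPolynomial.eval p
        (MvPolynomial.X 0 * MvPolynomial.pderiv 0 (MvPolynomial.X 0 * MvPolynomial.pderiv 0 ((∑ l, (MvPolynomial.X (0 : Fin 2) : MvPolynomial (Fin 2) ℝ) ^ d l •
              (S l).map (MvPolynomial.C : ℝ →+* MvPolynomial (Fin 2) ℝ)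
            + (MvPolynomial.X (1 : Fin 2) : MvPolynomial (Fin 2) ℝ) •
              (Matrix.fromBlocks 1 0 0 0 : Matrix (Fin r ⊕ Fin s) (Fin r ⊕ Fin s) ℝ).map
                (MvPolynomial.C : ℝ →+* MvPolynomial (Fin 2) ℝ)).det)) * (MvPolynomial.X 1 * MvPolynomial.pderiv 1 ((∑ l, (MvPolynomial.X (0 : Fin 2) : MvPolynomial (Fin 2) ℝ) ^ d l •
              (S l).map (MvPolynomial.C : ℝ →+* MvPolynomial (Fin 2) ℝ)
            + (MvPolynomial.X (1 : Fin 2) : MvPolynomial (Fin 2) ℝ) •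
              (Matrix.fromBlocks 1 0 0 0 : Matrix (Fin r ⊕ Fin s) (Fin r ⊕ Fin s) ℝ).map
                (MvPolynomial.C : ℝ →+* MvPolynomial (Fin 2) ℝ)).det)) ^ 2
          - 2 * (MvPolynomial.X 0 * MvPolynomial.pderiv 0 (MvPolynomial.X 1 * MvPolynomial.pderiv 1 ((∑ l, (MvPolynomial.X (0 : Fin 2) : MvPolynomial (Fin 2) ℝ) ^ d l •
              (S l).map (MvPolynomial.C : ℝ →+* MvPolynomial (Fin 2) ℝ)
            + (MvPolynomial.X (1 : Fin 2) : MvPolynomial (Fin 2) ℝ) •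
              (Matrix.fromBlocks 1 0 0 0 : Matrix (Fin r ⊕ Fin s) (Fin r ⊕ Fin s) ℝ).map
                (MvPolynomial.C : ℝ →+* MvPolynomial (Fin 2) ℝ)).det)))
            * (MvPolynomial.X 0 * MvPolynomial.pderiv 0 ((∑ l, (MvPolynomial.X (0 : Fin 2) : MvPolynomial (Fin 2) ℝ) ^ d l •
              (S l).map (MvPolynomial.C : ℝ →+* MvPolynomial (Fin 2) ℝ)
            + (MvPolynomial.X (1 : Fin 2) : MvPolynomial (Fin 2) ℝ) •
              (Matrix.fromBlocks 1 0 0 0 : Matrix (Fin r ⊕ Fin s) (Fin r ⊕ Fin s) ℝ).map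
                (MvPolynomial.C : ℝ →+* MvPolynomial (Fin 2) ℝ)).det)) * (MvPolynomial.X 1 * MvPolynomial.pderiv 1 ((∑ l, (MvPolynomial.X (0 : Fin 2) : MvPolynomial (Fin 2) ℝ) ^ d l •
              (S l).map (MvPolynomial.C : ℝ →+* MvPolynomial (Fin 2) ℝ)
            + (MvPolynomial.X (1 : Fin 2) : MvPolynomial (Fin 2) ℝ) •
              (Matrix.fromBlocks 1 0 0 0 : Matrix (Fin r ⊕ Fin s) (Fin r ⊕ Fin s) ℝ).map
                (MvPolynomial.C : ℝ →+* MvPolynomial (Fin 2) ℝ)).det))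
          + MvPolynomial.X 1 * MvPolynomial.pderiv 1 (MvPolynomial.X 1 * MvPolynomial.pderiv 1 ((∑ l, (MvPolynomial.X (0 : Fin 2) : MvPolynomial (Fin 2) ℝ) ^ d l •
              (S l).map (MvPolynomial.C : ℝ →+* MvPolynomial (Fin 2) ℝ)
            + (MvPolynomial.X (1 : Fin 2) : MvPolynomial (Fin 2) ℝ) •
              (Matrix.fromBlocks 1 0 0 0 : Matrix (Fin r ⊕ Fin s) (Fin r ⊕ Fin s) ℝ).map
                (MvPolynomial.C : ℝ →+* MvPolynomial (Fin 2) ℝ)).det)) * (MvPolynomial.X 0 * MvPolynomial.pderiv 0 ((∑ l, (MvPolynomial.X (0 : Fin 2) : MvPolynomial (Fin 2) ℝ) ^ d l •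
              (S l).map (MvPolynomial.C : ℝ →+* MvPolynomial (Fin 2) ℝ)
            + (MvPolynomial.X (1 : Fin 2) : MvPolynomial (Fin 2) ℝ) •
              (Matrix.fromBlocks 1 0 0 0 : Matrix (Fin r ⊕ Fin s) (Fin r ⊕ Fin s) ℝ).map
                (MvPolynomial.C : ℝ →+* MvPolynomial (Fin 2) ℝ)).det)) ^ 2) = 0}.Finite) :
    {p : Fin 2 → ℝ | 0 < p 0 ∧ 0 < p 1 ∧ MvPolynomial.eval p (∑ l, (MvPolynomial.X (0 : Fin 2) : MvPolynomial (Fin 2) ℝ) ^ d l •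
              (S l).map (MvPolynomial.C : ℝ →+* MvPolynomial (Fin 2) ℝ)
            + (MvPolynomial.X (1 : Fin 2) : MvPolynomial (Fin 2) ℝ) •
              (Matrix.fromBlocks 1 0 0 0 : Matrix (Fin r ⊕ Fin s) (Fin r ⊕ Fin s) ℝ).map
                (MvPolynomial.C : ℝ →+* MvPolynomial (Fin 2) ℝ)).det = 0 ∧
      MvPolynomial.eval p
        (MvPolynomial.X 0 * MvPolynomial.pderiv 0 (MvPolynomial.X 0 * MvPolynomial.pderiv 0 ((∑ l, (MvPolynomial.X (0 : Fin 2) : MvPolynomial (Fin 2) ℝ) ^ d l •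
              (S l).map (MvPolynomial.C : ℝ →+* MvPolynomial (Fin 2) ℝ)
            + (MvPolynomial.X (1 : Fin 2) : MvPolynomial (Fin 2) ℝ) •
              (Matrix.fromBlocks 1 0 0 0 : Matrix (Fin r ⊕ Fin s) (Fin r ⊕ Fin s) ℝ).map
                (MvPolynomial.C : ℝ →+* MvPolynomial (Fin 2) ℝ)).det)) * (MvPolynomial.X 1 * MvPolynomial.pderiv 1 ((∑ l, (MvPolynomial.X (0 : Fin 2) : MvPolynomial (Fin 2) ℝ) ^ d l •
              (S l).map (MvPolynomial.C : ℝ →+* MvPolynomial (Fin 2) ℝ)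
            + (MvPolynomial.X (1 : Fin 2) : MvPolynomial (Fin 2) ℝ) •
              (Matrix.fromBlocks 1 0 0 0 : Matrix (Fin r ⊕ Fin s) (Fin r ⊕ Fin s) ℝ).map
                (MvPolynomial.C : ℝ →+* MvPolynomial (Fin 2) ℝ)).det)) ^ 2
          - 2 * (MvPolynomial.X 0 * MvPolynomial.pderiv 0 (MvPolynomial.X 1 * MvPolynomial.pderiv 1 ((∑ l, (MvPolynomial.X (0 : Fin 2) : MvPolynomial (Fin 2) ℝ) ^ d l •
              (S l).map (MvPolynomial.C : ℝ →+* MvPolynomial (Fin 2) ℝ)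
            + (MvPolynomial.X (1 : Fin 2) : MvPolynomial (Fin 2) ℝ) •
              (Matrix.fromBlocks 1 0 0 0 : Matrix (Fin r ⊕ Fin s) (Fin r ⊕ Fin s) ℝ).map
                (MvPolynomial.C : ℝ →+* MvPolynomial (Fin 2) ℝ)).det)))
            * (MvPolynomial.X 0 * MvPolynomial.pderiv 0 ((∑ l, (MvPolynomial.X (0 : Fin 2) : MvPolynomial (Fin 2) ℝ) ^ d l •
              (S l).map (MvPolynomial.C : ℝ →+* MvPolynomial (Fin 2) ℝ)
            + (MvPolynomial.X (1 : Fin 2) : MvPolynomial (Fin 2) ℝ) •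
              (Matrix.fromBlocks 1 0 0 0 : Matrix (Fin r ⊕ Fin s) (Fin r ⊕ Fin s) ℝ).map
                (MvPolynomial.C : ℝ →+* MvPolynomial (Fin 2) ℝ)).det)) * (MvPolynomial.X 1 * MvPolynomial.pderiv 1 ((∑ l, (MvPolynomial.X (0 : Fin 2) : MvPolynomial (Fin 2) ℝ) ^ d l •
              (S l).map (MvPolynomial.C : ℝ →+* MvPolynomial (Fin 2) ℝ)
            + (MvPolynomial.X (1 : Fin 2) : MvPolynomial (Fin 2) ℝ) •
              (Matrix.fromBlocks 1 0 0 0 : Matrix (Fin r ⊕ Fin s) (Fin r ⊕ Fin s) ℝ).map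
                (MvPolynomial.C : ℝ →+* MvPolynomial (Fin 2) ℝ)).det))
          + MvPolynomial.X 1 * MvPolynomial.pderiv 1 (MvPolynomial.X 1 * MvPolynomial.pderiv 1 ((∑ l, (MvPolynomial.X (0 : Fin 2) : MvPolynomial (Fin 2) ℝ) ^ d l •
              (S l).map (MvPolynomial.C : ℝ →+* MvPolynomial (Fin 2) ℝ)
            + (MvPolynomial.X (1 : Fin 2) : MvPolynomial (Fin 2) ℝ) •
              (Matrix.fromBlocks 1 0 0 0 : Matrix (Fin r ⊕ Fin s) (Fin r ⊕ Fin s) ℝ).map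
                (MvPolynomial.C : ℝ →+* MvPolynomial (Fin 2) ℝ)).det)) * (MvPolynomial.X 0 * MvPolynomial.pderiv 0 ((∑ l, (MvPolynomial.X (0 : Fin 2) : MvPolynomial (Fin 2) ℝ) ^ d l •
              (S l).map (MvPolynomial.C : ℝ →+* MvPolynomial (Fin 2) ℝ)
            + (MvPolynomial.X (1 : Fin 2) : MvPolynomial (Fin 2) ℝ) •
              (Matrix.fromBlocks 1 0 0 0 : Matrix (Fin r ⊕ Fin s) (Fin r ⊕ Fin s) ℝ).map
                (MvPolynomial.C : ℝ →+* MvPolynomial (Fin 2) ℝ)).det)) ^ 2) = 0}.ncard ≤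
      r * (K.choose 2 - 1) + r.choose 2 * (K - 1) := by
  classical
  rw [insertionPoly_diagonal r s K d S hS] at hfin ⊢
  -- names
  set G : Fin r → ℝ[X] := fun i => ∑ l, Polynomial.C (S l (Sum.inl i) (Sum.inl i)) * X ^ d l with hG
  set M : ℝ[X] := ∏ j : Fin s, ∑ l, Polynomial.C (S l (Sum.inr j) (Sum.inr j)) * X ^ d l with hM
  set Ψ : MvPolynomial (Fin 2) ℝ := ∏ i : Fin r, (MvPolynomial.X 1 + Polynomial.aeval (MvPolynomial.X 0 : MvPolynomial (Fin 2) ℝ) (G i)) with hΨ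
  set O := {p : Fin 2 → ℝ | 0 < p 0 ∧ 0 < p 1 ∧ MvPolynomial.eval p (Ψ * Polynomial.aeval (MvPolynomial.X 0 : MvPolynomial (Fin 2) ℝ) M) = 0 ∧
      MvPolynomial.eval p
        (MvPolynomial.X 0 * MvPolynomial.pderiv 0 (MvPolynomial.X 0 * MvPolynomial.pderiv 0 (Ψ * Polynomial.aeval (MvPolynomial.X 0 : MvPolynomial (Fin 2) ℝ) M)) * (MvPolynomial.X 1 * MvPolynomial.pderiv 1 (Ψ * Polynomial.aeval (MvPolynomial.X 0 : MvPolynomial (Fin 2) ℝ) M)) ^ 2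
          - 2 * (MvPolynomial.X 0 * MvPolynomial.pderiv 0 (MvPolynomial.X 1 * MvPolynomial.pderiv 1 (Ψ * Polynomial.aeval (MvPolynomial.X 0 : MvPolynomial (Fin 2) ℝ) M)))
            * (MvPolynomial.X 0 * MvPolynomial.pderiv 0 (Ψ * Polynomial.aeval (MvPolynomial.X 0 : MvPolynomial (Fin 2) ℝ) M)) * (MvPolynomial.X 1 * MvPolynomial.pderiv 1 (Ψ * Polynomial.aeval (MvPolynomial.X 0 : MvPolynomial (Fin 2) ℝ) M))
          + MvPolynomial.X 1 * MvPolynomial.pderiv 1 (MvPolynomial.X 1 * MvPolynomial.pderiv 1 (Ψ * Polynomial.aeval (MvPolynomial.X 0 : MvPolynomial (Fin 2) ℝ) M)) * (MvPolynomial.X 0 * MvPolynomial.pderiv 0 (Ψ * Polynomial.aeval (MvPolynomial.X 0 : MvPolynomial (Fin 2) ℝ) M)) ^ 2) = 0} with hO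
  set OΨ := {p : Fin 2 → ℝ | 0 < p 0 ∧ 0 < p 1 ∧ MvPolynomial.eval p Ψ = 0 ∧
      MvPolynomial.eval p
        (MvPolynomial.X 0 * MvPolynomial.pderiv 0 (MvPolynomial.X 0 * MvPolynomial.pderiv 0 (Ψ)) * (MvPolynomial.X 1 * MvPolynomial.pderiv 1 (Ψ)) ^ 2
          - 2 * (MvPolynomial.X 0 * MvPolynomial.pderiv 0 (MvPolynomial.X 1 * MvPolynomial.pderiv 1 (Ψ)))
            * (MvPolynomial.X 0 * MvPolynomial.pderiv 0 (Ψ)) * (MvPolynomial.X 1 * MvPolynomial.pderiv 1 (Ψ))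
          + MvPolynomial.X 1 * MvPolynomial.pderiv 1 (MvPolynomial.X 1 * MvPolynomial.pderiv 1 (Ψ)) * (MvPolynomial.X 0 * MvPolynomial.pderiv 0 (Ψ)) ^ 2) = 0} with hOΨ
  -- `H(Φ)` on `Ψ = 0` and on `M = 0`
  have hH1 : ∀ p : Fin 2 → ℝ, MvPolynomial.eval p Ψ = 0 →
      MvPolynomial.eval p
        (MvPolynomial.X 0 * MvPolynomial.pderiv 0 (MvPolynomial.X 0 * MvPolynomial.pderiv 0 (Ψ * Polynomial.aeval (MvPolynomial.X 0 : MvPolynomial (Fin 2) ℝ) M)) * (MvPolynomial.X 1 * MvPolynomial.pderiv 1 (Ψ * Polynomial.aeval (MvPolynomial.X 0 : MvPolynomial (Fin 2) ℝ) M)) ^ 2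
          - 2 * (MvPolynomial.X 0 * MvPolynomial.pderiv 0 (MvPolynomial.X 1 * MvPolynomial.pderiv 1 (Ψ * Polynomial.aeval (MvPolynomial.X 0 : MvPolynomial (Fin 2) ℝ) M)))
            * (MvPolynomial.X 0 * MvPolynomial.pderiv 0 (Ψ * Polynomial.aeval (MvPolynomial.X 0 : MvPolynomial (Fin 2) ℝ) M)) * (MvPolynomial.X 1 * MvPolynomial.pderiv 1 (Ψ * Polynomial.aeval (MvPolynomial.X 0 : MvPolynomial (Fin 2) ℝ) M))
          + MvPolynomial.X 1 * MvPolynomial.pderiv 1 (MvPolynomial.X 1 * MvPolynomial.pderiv 1 (Ψ * Polynomial.aeval (MvPolynomial.X 0 : MvPolynomial (Fin 2) ℝ) M)) * (MvPolynomial.X 0 * MvPolynomial.pderiv 0 (Ψ * Polynomial.aeval (MvPolynomial.X 0 : MvPolynomial (Fin 2) ℝ) M)) ^ 2) =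
      MvPolynomial.eval p (Polynomial.aeval (MvPolynomial.X 0 : MvPolynomial (Fin 2) ℝ) M) ^ 3 * MvPolynomial.eval p
        (MvPolynomial.X 0 * MvPolynomial.pderiv 0 (MvPolynomial.X 0 * MvPolynomial.pderiv 0 (Ψ)) * (MvPolynomial.X 1 * MvPolynomial.pderiv 1 (Ψ)) ^ 2
          - 2 * (MvPolynomial.X 0 * MvPolynomial.pderiv 0 (MvPolynomial.X 1 * MvPolynomial.pderiv 1 (Ψ)))
            * (MvPolynomial.X 0 * MvPolynomial.pderiv 0 (Ψ)) * (MvPolynomial.X 1 * MvPolynomial.pderiv 1 (Ψ))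
          + MvPolynomial.X 1 * MvPolynomial.pderiv 1 (MvPolynomial.X 1 * MvPolynomial.pderiv 1 (Ψ)) * (MvPolynomial.X 0 * MvPolynomial.pderiv 0 (Ψ)) ^ 2) :=
    fun p hp => OsculationGeneric.eval_logHessian_mul_of_eval_eq_zero Ψ _ p hp
  have hH2 : ∀ p : Fin 2 → ℝ, M.eval (p 0) = 0 →
      MvPolynomial.eval p
        (MvPolynomial.X 0 * MvPolynomial.pderiv 0 (MvPolynomial.X 0 * MvPolynomial.pderiv 0 (Ψ * Polynomial.aeval (MvPolynomial.X 0 : MvPolynomial (Fin 2) ℝ) M)) * (MvPolynomial.X 1 * MvPolynomial.pderiv 1 (Ψ * Polynomial.aeval (MvPolynomial.X 0 : MvPolynomial (Fin 2) ℝ) M)) ^ 2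
          - 2 * (MvPolynomial.X 0 * MvPolynomial.pderiv 0 (MvPolynomial.X 1 * MvPolynomial.pderiv 1 (Ψ * Polynomial.aeval (MvPolynomial.X 0 : MvPolynomial (Fin 2) ℝ) M)))
            * (MvPolynomial.X 0 * MvPolynomial.pderiv 0 (Ψ * Polynomial.aeval (MvPolynomial.X 0 : MvPolynomial (Fin 2) ℝ) M)) * (MvPolynomial.X 1 * MvPolynomial.pderiv 1 (Ψ * Polynomial.aeval (MvPolynomial.X 0 : MvPolynomial (Fin 2) ℝ) M))
          + MvPolynomial.X 1 * MvPolynomial.pderiv 1 (MvPolynomial.X 1 * MvPolynomial.pderiv 1 (Ψ * Polynomial.aeval (MvPolynomial.X 0 : MvPolynomial (Fin 2) ℝ) M)) * (MvPolynomial.X 0 * MvPolynomial.pderiv 0 (Ψ * Polynomial.aeval (MvPolynomial.X 0 : MvPolynomial (Fin 2) ℝ) M)) ^ 2) = 0 := by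
    intro p hp
    rw [mul_comm Ψ, OsculationGeneric.eval_logHessian_mul_of_eval_eq_zero _ Ψ p (by rw [OsculationRankOne.eval_aevalX0, hp]),
      logHessian_aevalX0, map_zero, mul_zero]
  -- `OΨ ⊆ O`, hence `OΨ` is finite
  have hsub1 : OΨ ⊆ O := by
    rintro p ⟨ht, hb, h0, hH0⟩
    refine ⟨ht, hb, by rw [map_mul, h0, zero_mul], by rw [hH1 p h0, hH0, mul_zero]⟩
  have hfinΨ : OΨ.Finite := hfin.subset hsub1
  -- no vertical ray: `M` has no positive root
  have hMpos : ∀ t : ℝ, 0 < t → M.eval t ≠ 0 := by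
    intro t ht hMt
    refine hfin.not_infinite (OsculationCuspGen.infinite_of_vertical t fun b hb => ⟨by simpa using ht, by simpa using hb, ?_, ?_⟩)
    · rw [map_mul, OsculationRankOne.eval_aevalX0]
      simp [hMt]
    · exact hH2 _ (by simpa using hMt)
  -- `O ⊆ OΨ`
  have hsub2 : O ⊆ OΨ := by
    rintro p ⟨ht, hb, h0, hH0⟩
    have hM0 : MvPolynomial.eval p (Polynomial.aeval (MvPolynomial.X 0 : MvPolynomial (Fin 2) ℝ) M) ≠ 0 := by
      rw [OsculationRankOne.eval_aevalX0]; exact hMpos _ ht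
    have hΨ0 : MvPolynomial.eval p Ψ = 0 := by
      rw [map_mul] at h0
      exact (mul_eq_zero.1 h0).resolve_right hM0
    refine ⟨ht, hb, hΨ0, ?_⟩
    rw [hH1 p hΨ0] at hH0
    exact (mul_eq_zero.1 hH0).resolve_left (pow_ne_zero 3 hM0)
  -- the sheet count
  have hcount := sheetProduct_count (Finset.univ.image d) G (fun i => support_entry_subset d S (Sum.inl i)) Ψ rfl hfinΨ
  have hcard : (Finset.univ.image d).card ≤ K := Finset.card_image_le.trans (by simp)
  calc O.ncard ≤ OΨ.ncard := Set.ncard_le_ncard hsub2 hfinΨ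
    _ ≤ r * ((Finset.univ.image d).card.choose 2 - 1) + r.choose 2 * ((Finset.univ.image d).card - 1) := hcount
    _ ≤ r * (K.choose 2 - 1) + r.choose 2 * (K - 1) := by
        gcongr

/-- **The COMMUTING column, diagonal form, line shape** (`OsculationLawAt`-style: every splitting `r + s = m` of a
DIAGONAL `(m, K)` pencil; `r·(C(K,2) − 1) + C(r,2)·(K − 1) ≤ m·K² + m²·K`). [folklore] -/
theorem osc_diagonal_le (m K : ℕ) (r s : ℕ) (hrs : r + s = m) (d : Fin K → ℕ)
    (S : Fin K → Matrix (Fin r ⊕ Fin s) (Fin r ⊕ Fin s) ℝ) (hS : ∀ l, (S l).IsDiag)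
    (hfin : {p : Fin 2 → ℝ | 0 < p 0 ∧ 0 < p 1 ∧ MvPolynomial.eval p (∑ l, (MvPolynomial.X (0 : Fin 2) : MvPolynomial (Fin 2) ℝ) ^ d l •
              (S l).map (MvPolynomial.C : ℝ →+* MvPolynomial (Fin 2) ℝ)
            + (MvPolynomial.X (1 : Fin 2) : MvPolynomial (Fin 2) ℝ) •
              (Matrix.fromBlocks 1 0 0 0 : Matrix (Fin r ⊕ Fin s) (Fin r ⊕ Fin s) ℝ).map
                (MvPolynomial.C : ℝ →+* MvPolynomial (Fin 2) ℝ)).det = 0 ∧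
      MvPolynomial.eval p
        (MvPolynomial.X 0 * MvPolynomial.pderiv 0 (MvPolynomial.X 0 * MvPolynomial.pderiv 0 ((∑ l, (MvPolynomial.X (0 : Fin 2) : MvPolynomial (Fin 2) ℝ) ^ d l •
              (S l).map (MvPolynomial.C : ℝ →+* MvPolynomial (Fin 2) ℝ)
            + (MvPolynomial.X (1 : Fin 2) : MvPolynomial (Fin 2) ℝ) •
              (Matrix.fromBlocks 1 0 0 0 : Matrix (Fin r ⊕ Fin s) (Fin r ⊕ Fin s) ℝ).map
                (MvPolynomial.C : ℝ →+* MvPolynomial (Fin 2) ℝ)).det)) * (MvPolynomial.X 1 * MvPolynomial.pderiv 1 ((∑ l, (MvPolynomial.X (0 : Fin 2) : MvPolynomial (Fin 2) ℝ) ^ d l •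
              (S l).map (MvPolynomial.C : ℝ →+* MvPolynomial (Fin 2) ℝ)
            + (MvPolynomial.X (1 : Fin 2) : MvPolynomial (Fin 2) ℝ) •
              (Matrix.fromBlocks 1 0 0 0 : Matrix (Fin r ⊕ Fin s) (Fin r ⊕ Fin s) ℝ).map
                (MvPolynomial.C : ℝ →+* MvPolynomial (Fin 2) ℝ)).det)) ^ 2
          - 2 * (MvPolynomial.X 0 * MvPolynomial.pderiv 0 (MvPolynomial.X 1 * MvPolynomial.pderiv 1 ((∑ l, (MvPolynomial.X (0 : Fin 2) : MvPolynomial (Fin 2) ℝ) ^ d l •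
              (S l).map (MvPolynomial.C : ℝ →+* MvPolynomial (Fin 2) ℝ)
            + (MvPolynomial.X (1 : Fin 2) : MvPolynomial (Fin 2) ℝ) •
              (Matrix.fromBlocks 1 0 0 0 : Matrix (Fin r ⊕ Fin s) (Fin r ⊕ Fin s) ℝ).map
                (MvPolynomial.C : ℝ →+* MvPolynomial (Fin 2) ℝ)).det)))
            * (MvPolynomial.X 0 * MvPolynomial.pderiv 0 ((∑ l, (MvPolynomial.X (0 : Fin 2) : MvPolynomial (Fin 2) ℝ) ^ d l •
              (S l).map (MvPolynomial.C : ℝ →+* MvPolynomial (Fin 2) ℝ)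
            + (MvPolynomial.X (1 : Fin 2) : MvPolynomial (Fin 2) ℝ) •
              (Matrix.fromBlocks 1 0 0 0 : Matrix (Fin r ⊕ Fin s) (Fin r ⊕ Fin s) ℝ).map
                (MvPolynomial.C : ℝ →+* MvPolynomial (Fin 2) ℝ)).det)) * (MvPolynomial.X 1 * MvPolynomial.pderiv 1 ((∑ l, (MvPolynomial.X (0 : Fin 2) : MvPolynomial (Fin 2) ℝ) ^ d l •
              (S l).map (MvPolynomial.C : ℝ →+* MvPolynomial (Fin 2) ℝ)
            + (MvPolynomial.X (1 : Fin 2) : MvPolynomial (Fin 2) ℝ) •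
              (Matrix.fromBlocks 1 0 0 0 : Matrix (Fin r ⊕ Fin s) (Fin r ⊕ Fin s) ℝ).map
                (MvPolynomial.C : ℝ →+* MvPolynomial (Fin 2) ℝ)).det))
          + MvPolynomial.X 1 * MvPolynomial.pderiv 1 (MvPolynomial.X 1 * MvPolynomial.pderiv 1 ((∑ l, (MvPolynomial.X (0 : Fin 2) : MvPolynomial (Fin 2) ℝ) ^ d l •
              (S l).map (MvPolynomial.C : ℝ →+* MvPolynomial (Fin 2) ℝ)
            + (MvPolynomial.X (1 : Fin 2) : MvPolynomial (Fin 2) ℝ) •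
              (Matrix.fromBlocks 1 0 0 0 : Matrix (Fin r ⊕ Fin s) (Fin r ⊕ Fin s) ℝ).map
                (MvPolynomial.C : ℝ →+* MvPolynomial (Fin 2) ℝ)).det)) * (MvPolynomial.X 0 * MvPolynomial.pderiv 0 ((∑ l, (MvPolynomial.X (0 : Fin 2) : MvPolynomial (Fin 2) ℝ) ^ d l •
              (S l).map (MvPolynomial.C : ℝ →+* MvPolynomial (Fin 2) ℝ)
            + (MvPolynomial.X (1 : Fin 2) : MvPolynomial (Fin 2) ℝ) •
              (Matrix.fromBlocks 1 0 0 0 : Matrix (Fin r ⊕ Fin s) (Fin r ⊕ Fin s) ℝ).map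
                (MvPolynomial.C : ℝ →+* MvPolynomial (Fin 2) ℝ)).det)) ^ 2) = 0}.Finite) :
    {p : Fin 2 → ℝ | 0 < p 0 ∧ 0 < p 1 ∧ MvPolynomial.eval p (∑ l, (MvPolynomial.X (0 : Fin 2) : MvPolynomial (Fin 2) ℝ) ^ d l •
              (S l).map (MvPolynomial.C : ℝ →+* MvPolynomial (Fin 2) ℝ)
            + (MvPolynomial.X (1 : Fin 2) : MvPolynomial (Fin 2) ℝ) •
              (Matrix.fromBlocks 1 0 0 0 : Matrix (Fin r ⊕ Fin s) (Fin r ⊕ Fin s) ℝ).map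
                (MvPolynomial.C : ℝ →+* MvPolynomial (Fin 2) ℝ)).det = 0 ∧
      MvPolynomial.eval p
        (MvPolynomial.X 0 * MvPolynomial.pderiv 0 (MvPolynomial.X 0 * MvPolynomial.pderiv 0 ((∑ l, (MvPolynomial.X (0 : Fin 2) : MvPolynomial (Fin 2) ℝ) ^ d l •
              (S l).map (MvPolynomial.C : ℝ →+* MvPolynomial (Fin 2) ℝ)
            + (MvPolynomial.X (1 : Fin 2) : MvPolynomial (Fin 2) ℝ) •
              (Matrix.fromBlocks 1 0 0 0 : Matrix (Fin r ⊕ Fin s) (Fin r ⊕ Fin s) ℝ).map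
                (MvPolynomial.C : ℝ →+* MvPolynomial (Fin 2) ℝ)).det)) * (MvPolynomial.X 1 * MvPolynomial.pderiv 1 ((∑ l, (MvPolynomial.X (0 : Fin 2) : MvPolynomial (Fin 2) ℝ) ^ d l •
              (S l).map (MvPolynomial.C : ℝ →+* MvPolynomial (Fin 2) ℝ)
            + (MvPolynomial.X (1 : Fin 2) : MvPolynomial (Fin 2) ℝ) •
              (Matrix.fromBlocks 1 0 0 0 : Matrix (Fin r ⊕ Fin s) (Fin r ⊕ Fin s) ℝ).map
                (MvPolynomial.C : ℝ →+* MvPolynomial (Fin 2) ℝ)).det)) ^ 2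
          - 2 * (MvPolynomial.X 0 * MvPolynomial.pderiv 0 (MvPolynomial.X 1 * MvPolynomial.pderiv 1 ((∑ l, (MvPolynomial.X (0 : Fin 2) : MvPolynomial (Fin 2) ℝ) ^ d l •
              (S l).map (MvPolynomial.C : ℝ →+* MvPolynomial (Fin 2) ℝ)
            + (MvPolynomial.X (1 : Fin 2) : MvPolynomial (Fin 2) ℝ) •
              (Matrix.fromBlocks 1 0 0 0 : Matrix (Fin r ⊕ Fin s) (Fin r ⊕ Fin s) ℝ).map
                (MvPolynomial.C : ℝ →+* MvPolynomial (Fin 2) ℝ)).det)))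
            * (MvPolynomial.X 0 * MvPolynomial.pderiv 0 ((∑ l, (MvPolynomial.X (0 : Fin 2) : MvPolynomial (Fin 2) ℝ) ^ d l •
              (S l).map (MvPolynomial.C : ℝ →+* MvPolynomial (Fin 2) ℝ)
            + (MvPolynomial.X (1 : Fin 2) : MvPolynomial (Fin 2) ℝ) •
              (Matrix.fromBlocks 1 0 0 0 : Matrix (Fin r ⊕ Fin s) (Fin r ⊕ Fin s) ℝ).map
                (MvPolynomial.C : ℝ →+* MvPolynomial (Fin 2) ℝ)).det)) * (MvPolynomial.X 1 * MvPolynomial.pderiv 1 ((∑ l, (MvPolynomial.X (0 : Fin 2) : MvPolynomial (Fin 2) ℝ) ^ d l •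
              (S l).map (MvPolynomial.C : ℝ →+* MvPolynomial (Fin 2) ℝ)
            + (MvPolynomial.X (1 : Fin 2) : MvPolynomial (Fin 2) ℝ) •
              (Matrix.fromBlocks 1 0 0 0 : Matrix (Fin r ⊕ Fin s) (Fin r ⊕ Fin s) ℝ).map
                (MvPolynomial.C : ℝ →+* MvPolynomial (Fin 2) ℝ)).det))
          + MvPolynomial.X 1 * MvPolynomial.pderiv 1 (MvPolynomial.X 1 * MvPolynomial.pderiv 1 ((∑ l, (MvPolynomial.X (0 : Fin 2) : MvPolynomial (Fin 2) ℝ) ^ d l •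
              (S l).map (MvPolynomial.C : ℝ →+* MvPolynomial (Fin 2) ℝ)
            + (MvPolynomial.X (1 : Fin 2) : MvPolynomial (Fin 2) ℝ) •
              (Matrix.fromBlocks 1 0 0 0 : Matrix (Fin r ⊕ Fin s) (Fin r ⊕ Fin s) ℝ).map
                (MvPolynomial.C : ℝ →+* MvPolynomial (Fin 2) ℝ)).det)) * (MvPolynomial.X 0 * MvPolynomial.pderiv 0 ((∑ l, (MvPolynomial.X (0 : Fin 2) : MvPolynomial (Fin 2) ℝ) ^ d l •
              (S l).map (MvPolynomial.C : ℝ →+* MvPolynomial (Fin 2) ℝ)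
            + (MvPolynomial.X (1 : Fin 2) : MvPolynomial (Fin 2) ℝ) •
              (Matrix.fromBlocks 1 0 0 0 : Matrix (Fin r ⊕ Fin s) (Fin r ⊕ Fin s) ℝ).map
                (MvPolynomial.C : ℝ →+* MvPolynomial (Fin 2) ℝ)).det)) ^ 2) = 0}.ncard ≤ m * K ^ 2 + m ^ 2 * K := by
  refine (osc_diagonal r s K d S hS hfin).trans ?_
  have h1 : K.choose 2 - 1 ≤ K ^ 2 := by
    have : K.choose 2 ≤ K ^ 2 := Nat.choose_le_pow K 2
    omega
  have h2 : r.choose 2 ≤ r ^ 2 := Nat.choose_le_pow r 2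
  have h3 : r ≤ m := by omega
  calc r * (K.choose 2 - 1) + r.choose 2 * (K - 1) ≤ m * K ^ 2 + r ^ 2 * K := by
        gcongr
        omega
    _ ≤ m * K ^ 2 + m ^ 2 * K := by gcongr

end OsculationCommuting

end Summit.ValiantsHypothesis.ValiantsHypothesis.Theorems.LacunarySymmetroidMatrixDescartes

end
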